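import Summits.Ventures.CertifiedManyBodySolver.Upper.UMPSDualBound
import Literature.LinearAlgebra.Matrix.PolarOrthonormalization
import HarnessLib

/-!
# uMPS dual certificates from DYADIC tensors, I: the polar tensor and the stacked transfer identities

HONEST FRAMING: first certified bounds; not a superconductivity verdict; every number certified or
labelled float.

Venture `Ventures/CertifiedManyBodySolver` (sr-mbsolver), U1-LEMMAS L9 (METHOD-umps §3, Lemma P),
part I of II (part II: `UMPSPolarCorrection.lean`). The tensor-side dual bound of
`UMPSDualBound.lean` needs an EXACTLY left-isometric tensor `Σ_s (A s)ᴴ (A s) = 1`; a certificate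
stores a dyadic tensor `A` that is only nearly isometric. Here: the Gram matrix `gram A`, the
polar-corrected tensor `polarTensor A = (A s · G^{-1/2})_s` (Löwdin orthonormalisation; tree:
`Literature.LinearAlgebra.Matrix.PolarOrthonormalization`, Horn–Johnson Thm. 7.3.1 (c)), its EXACT
isometry from the readers' max-row-sum hypothesis `Σ_j ‖(G - 1) i j‖ ≤ ε < 1`
(`sum_conjTranspose_polarTensor_mul_self`), and the algebra used by part II: vertical stacks
`stack`, `[C]ᴴ[C'] = Σ_p (C p)ᴴ(C' p)`, `[C]ᴴ (X ⊗ 1) [C'] = Σ X_{pp'} (C p)ᴴ (C' p')`, Kronecker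
sandwiches `X ≤ γ·1 ⟹ X ⊗ 1 ≤ γ·1`, the polarisation identity, and the two-site transfer identity
`Σ_{(s₁,s₂)} (A s₁ M A s₂)ᴴ (A s₁ N A s₂) = Φ_A(Mᴴ G N)` with its consequences
`Y_X(A) = [A p₁ A p₂]ᴴ (X ⊗ 1) [A p₁ A p₂]`, `Φ_Ã(B) = S Φ_A(B) S`,
`Y_X(Ã) = S [A p₁ S A p₂]ᴴ (X ⊗ 1) [A p₁ S A p₂] S` (`S = G^{-1/2}`).

References: VAR team, `HOME/var/METHOD-umps.md` v1.1 §3 and `HOME/var/U1-LEMMAS.md` L9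
(sr-mbsolver, 2026-08-20); R. A. Horn, C. R. Johnson, *Matrix Analysis* (2013) Thm. 7.3.1 (c),
Thm. 7.7.2 (a).
-/

noncomputable section

open Matrix Finset
open scoped ComplexOrder MatrixOrder Kronecker BigOperators

namespace Summit.Ventures.CertifiedManyBodySolver.Upper

open Literature.MathematicalPhysics.QuantumLattice Literature.LinearAlgebra.Matrix
open Literature.LinearAlgebra.Matrix.PolarOrthonormalization

/-! ### Stacking a family of matrices; Kronecker sandwiches -/

section Stack

variable {ι m n k : Type*} [Fintype ι] [Fintype m] [Fintype n]

/-- Vertical stacking `[C p]_p` of a family of `m × n` matrices into an `(ι × m) × n` matrix. -/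
def stack (C : ι → Matrix m n ℂ) : Matrix (ι × m) n ℂ := Matrix.of fun pi j => C pi.1 pi.2 j

omit [Fintype ι] [Fintype m] [Fintype n] in
/-- Entries of a stack. -/
@[simp] theorem stack_apply (C : ι → Matrix m n ℂ) (p : ι) (i : m) (j : n) :
    stack C (p, i) j = C p i j := rfl

omit [Fintype ι] [Fintype m] [Fintype n] in
/-- Stacking is additive. -/
theorem stack_add (C C' : ι → Matrix m n ℂ) :
    stack (fun p => C p + C' p) = stack C + stack C' := by
  ext ⟨p, i⟩ j; rfl

omit [Fintype ι] [Fintype m] [Fintype n] in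
/-- Stacking commutes with subtraction. -/
theorem stack_sub (C C' : ι → Matrix m n ℂ) :
    stack (fun p => C p - C' p) = stack C - stack C' := by
  ext ⟨p, i⟩ j; rfl

omit [Fintype ι] [Fintype m] [Fintype n] in
/-- Stacking commutes with scalars. -/
theorem stack_smul (c : ℂ) (C : ι → Matrix m n ℂ) :
    stack (fun p => c • C p) = c • stack C := by
  ext ⟨p, i⟩ j; rfl

omit [Fintype ι] [Fintype m] in
/-- Stacking commutes with right multiplication: `[C p N]_p = [C p]_p N`. -/
theorem stack_mul (C : ι → Matrix m n ℂ) (N : Matrix n k ℂ) :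
    stack (fun p => C p * N) = stack C * N := by
  ext ⟨p, i⟩ j
  simp [stack, Matrix.mul_apply]

omit [Fintype n] in
/-- `[C]ᴴ [C'] = Σ_p (C p)ᴴ (C' p)`. -/
theorem conjTranspose_stack_mul_stack (C C' : ι → Matrix m n ℂ) :
    (stack C)ᴴ * stack C' = ∑ p, (C p)ᴴ * C' p := by
  ext j j'
  simp [Matrix.mul_apply, Matrix.sum_apply, Fintype.sum_prod_type]

omit [Fintype n] in
/-- `[C]ᴴ (X ⊗ 1) [C'] = Σ_{p p'} X_{p p'} (C p)ᴴ (C' p')`. -/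
theorem conjTranspose_stack_mul_kronecker_mul_stack [DecidableEq m] (X : Matrix ι ι ℂ)
    (C C' : ι → Matrix m n ℂ) :
    (stack C)ᴴ * (X ⊗ₖ (1 : Matrix m m ℂ)) * stack C' = ∑ p, ∑ p', X p p' • ((C p)ᴴ * C' p') := by
  ext j j'
  rw [Matrix.mul_assoc]
  simp only [Matrix.mul_apply, Matrix.sum_apply, Matrix.smul_apply, conjTranspose_apply, smul_eq_mul,
    Fintype.sum_prod_type, stack_apply, Matrix.kroneckerMap_apply, Matrix.one_apply, mul_ite, mul_one,
    mul_zero, ite_mul, zero_mul, Finset.sum_ite_eq, Finset.mem_univ, if_true, Finset.mul_sum]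
  refine Finset.sum_congr rfl fun p _ => ?_
  rw [Finset.sum_comm]
  refine Finset.sum_congr rfl fun p' _ => Finset.sum_congr rfl fun i _ => ?_
  ring

omit [Fintype n] in
/-- Kronecker product with the identity preserves an upper Loewner bound by a scalar. -/
theorem kronecker_one_le_smul_one [DecidableEq ι] [DecidableEq m] {X : Matrix ι ι ℂ} {γ : ℝ}
    (hX : X ≤ (γ : ℂ) • (1 : Matrix ι ι ℂ)) :
    X ⊗ₖ (1 : Matrix m m ℂ) ≤ (γ : ℂ) • (1 : Matrix (ι × m) (ι × m) ℂ) := by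
  rw [Matrix.le_iff] at hX ⊢
  have h := hX.kronecker (PosSemidef.one (n := m) (R := ℂ))
  have he : ((γ : ℂ) • (1 : Matrix ι ι ℂ) - X) ⊗ₖ (1 : Matrix m m ℂ) =
      (γ : ℂ) • (1 : Matrix (ι × m) (ι × m) ℂ) - X ⊗ₖ (1 : Matrix m m ℂ) := by
    ext ⟨i, k⟩ ⟨j, l⟩
    simp [Matrix.kroneckerMap_apply, Matrix.one_apply]
    split_ifs <;> simp_all
  rwa [he] at h

omit [Fintype n] in
/-- Kronecker product with the identity preserves a lower Loewner bound by a scalar. -/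
theorem neg_smul_one_le_kronecker_one [DecidableEq ι] [DecidableEq m] {X : Matrix ι ι ℂ} {γ : ℝ}
    (hX : -((γ : ℂ) • (1 : Matrix ι ι ℂ)) ≤ X) :
    -((γ : ℂ) • (1 : Matrix (ι × m) (ι × m) ℂ)) ≤ X ⊗ₖ (1 : Matrix m m ℂ) := by
  rw [Matrix.le_iff] at hX ⊢
  have h := hX.kronecker (PosSemidef.one (n := m) (R := ℂ))
  have he : (X - -((γ : ℂ) • (1 : Matrix ι ι ℂ))) ⊗ₖ (1 : Matrix m m ℂ) =
      X ⊗ₖ (1 : Matrix m m ℂ) - -((γ : ℂ) • (1 : Matrix (ι × m) (ι × m) ℂ)) := by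
    ext ⟨i, k⟩ ⟨j, l⟩
    simp [Matrix.kroneckerMap_apply, Matrix.one_apply]
    split_ifs <;> simp_all
  rwa [he] at h

omit [Fintype ι] [Fintype m] [Fintype n] in
/-- The polarisation identity `(Q + P/2)ᴴ 𝕏 (Q + P/2) - (Q - P/2)ᴴ 𝕏 (Q - P/2) = Pᴴ 𝕏 Q + Qᴴ 𝕏 P`. -/
theorem polar_identity {l : Type*} [Fintype l] (𝕏 : Matrix l l ℂ) (P Q : Matrix l n ℂ) :
    (Q + ((2⁻¹ : ℝ) : ℂ) • P)ᴴ * 𝕏 * (Q + ((2⁻¹ : ℝ) : ℂ) • P) -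
      (Q - ((2⁻¹ : ℝ) : ℂ) • P)ᴴ * 𝕏 * (Q - ((2⁻¹ : ℝ) : ℂ) • P) = Pᴴ * 𝕏 * Q + Qᴴ * 𝕏 * P := by
  have hc : ((2⁻¹ : ℝ) : ℂ) = (2 : ℂ)⁻¹ := by
    rw [Complex.ofReal_inv, Complex.ofReal_ofNat]
  have hstar : star ((2 : ℂ)⁻¹) = (2 : ℂ)⁻¹ := by simp
  rw [hc]
  simp only [conjTranspose_add, conjTranspose_sub, conjTranspose_smul, hstar, Matrix.add_mul,
    Matrix.mul_add, Matrix.sub_mul, Matrix.mul_sub, Matrix.smul_mul, Matrix.mul_smul]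
  module

end Stack

/-! ### Scalar bookkeeping with `Complex.ofReal` casts

The Literature lemmas are stated for any `RCLike 𝕜` (casts `RCLike.ofReal`); the two wrappers below
restate the scalar monotonicity facts with the `ℂ` coercion so that real arguments are never
inferred through a cast. -/

section Casts

variable {n : Type*} [Fintype n] [DecidableEq n]

omit [Fintype n] in
/-- `x ≤ y ⟹ x·1 ≤ y·1` (Loewner), `ℂ`-coercion form. -/
theorem smul_one_le_smul_one_complex {x y : ℝ} (h : x ≤ y) :
    (x : ℂ) • (1 : Matrix n n ℂ) ≤ (y : ℂ) • (1 : Matrix n n ℂ) :=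
  smul_one_le_smul_one h

omit [Fintype n] in
/-- `X ≤ ξ·1`, `0 ≤ c` ⟹ `c·X ≤ (cξ)·1`, `ℂ`-coercion form. -/
theorem smul_le_smul_one_complex {X : Matrix n n ℂ} {ξ c : ℝ}
    (h : X ≤ (ξ : ℂ) • (1 : Matrix n n ℂ)) (hc : 0 ≤ c) :
    (c : ℂ) • X ≤ ((c * ξ : ℝ) : ℂ) • (1 : Matrix n n ℂ) :=
  smul_le_smul_one h hc

end Casts

/-! ### The Gram matrix, the polar tensor, and the transfer identities -/

variable {q D : ℕ}

/-- The Gram matrix `G = Σ_s (A s)ᴴ (A s)` of an MPS tensor (`= Φ_A(1)`). -/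
def gram (A : MPSTensor q D) : Matrix (Fin D) (Fin D) ℂ := ∑ s, (A s)ᴴ * A s

/-- The polar-corrected (Löwdin-orthonormalised) tensor `Ã s = A s · G^{-1/2}`. -/
def polarTensor (A : MPSTensor q D) : MPSTensor q D := fun s => A s * invSqrt (gram A)

/-- The Gram matrix is Hermitian. -/
theorem gram_isHermitian (A : MPSTensor q D) : (gram A).IsHermitian :=
  isSelfAdjoint_sum Finset.univ fun s _ => isHermitian_conjTranspose_mul_self (A s)

/-- `Φ_A(1) = G`. -/
theorem heisenberg_one (A : MPSTensor q D) : heisenberg A 1 = gram A := by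
  simp [heisenberg, gram]

/-- `Φ_A` is homogeneous. -/
theorem heisenberg_smul (A : MPSTensor q D) (c : ℂ) (B : Matrix (Fin D) (Fin D) ℂ) :
    heisenberg A (c • B) = c • heisenberg A B := by
  simp [heisenberg, Finset.smul_sum]

/-- `Φ_A` respects subtraction. -/
theorem heisenberg_sub (A : MPSTensor q D) (B B' : Matrix (Fin D) (Fin D) ℂ) :
    heisenberg A (B - B') = heisenberg A B - heisenberg A B' := by
  simp [heisenberg, Matrix.mul_sub, Matrix.sub_mul, Finset.sum_sub_distrib]

/-- `Φ_A` respects negation. -/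
theorem heisenberg_neg (A : MPSTensor q D) (B : Matrix (Fin D) (Fin D) ℂ) :
    heisenberg A (-B) = -heisenberg A B := by
  simp [heisenberg, Finset.sum_neg_distrib]

/-- `Φ_A` is monotone in the Loewner order (a Kraus map). -/
theorem heisenberg_mono (A : MPSTensor q D) {B B' : Matrix (Fin D) (Fin D) ℂ} (h : B ≤ B') :
    heisenberg A B ≤ heisenberg A B' :=
  sum_conj_le_sum_conj h A

/-- `B ≤ ξ·1`, `G ≤ a·1`, `0 ≤ ξ` ⟹ `Φ_A(B) ≤ (ξ a)·1`. -/
theorem heisenberg_le_smul_one (A : MPSTensor q D) {B : Matrix (Fin D) (Fin D) ℂ} {ξ a : ℝ}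
    (hξ : 0 ≤ ξ) (hB : B ≤ (ξ : ℂ) • (1 : Matrix (Fin D) (Fin D) ℂ))
    (ha : gram A ≤ (a : ℂ) • (1 : Matrix (Fin D) (Fin D) ℂ)) :
    heisenberg A B ≤ ((ξ * a : ℝ) : ℂ) • (1 : Matrix (Fin D) (Fin D) ℂ) := by
  have h1 := heisenberg_mono A hB
  rw [heisenberg_smul, heisenberg_one] at h1
  exact h1.trans (smul_le_smul_one_complex ha hξ)

/-- `-ξ·1 ≤ B`, `G ≤ a·1`, `0 ≤ ξ` ⟹ `-(ξ a)·1 ≤ Φ_A(B)`. -/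
theorem neg_smul_one_le_heisenberg (A : MPSTensor q D) {B : Matrix (Fin D) (Fin D) ℂ} {ξ a : ℝ}
    (hξ : 0 ≤ ξ) (hB : -((ξ : ℂ) • (1 : Matrix (Fin D) (Fin D) ℂ)) ≤ B)
    (ha : gram A ≤ (a : ℂ) • (1 : Matrix (Fin D) (Fin D) ℂ)) :
    -(((ξ * a : ℝ) : ℂ) • (1 : Matrix (Fin D) (Fin D) ℂ)) ≤ heisenberg A B := by
  have h1 := heisenberg_mono A hB
  rw [heisenberg_neg, heisenberg_smul, heisenberg_one] at h1
  exact (neg_le_neg (smul_le_smul_one_complex ha hξ)).trans h1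

/-- **The transfer identity for two-site stacks**:
`Σ_{(s₁,s₂)} (A s₁ M A s₂)ᴴ (A s₁ N A s₂) = Φ_A(Mᴴ G N)`. -/
theorem sum_conjTranspose_twoSite_mul_twoSite (A : MPSTensor q D) (M N : Matrix (Fin D) (Fin D) ℂ) :
    ∑ p : Fin q × Fin q, (A p.1 * M * A p.2)ᴴ * (A p.1 * N * A p.2) =
      heisenberg A (Mᴴ * gram A * N) := by
  rw [heisenberg, gram, Fintype.sum_prod_type, Finset.sum_comm]
  refine Finset.sum_congr rfl fun s₂ _ => ?_
  simp only [conjTranspose_mul, Matrix.mul_assoc, Finset.mul_sum, Finset.sum_mul]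

/-- `[A p₁ M A p₂]ᴴ [A p₁ N A p₂] = Φ_A(Mᴴ G N)` in stacked form. -/
theorem conjTranspose_stack_twoSite_mul (A : MPSTensor q D) (M N : Matrix (Fin D) (Fin D) ℂ) :
    (stack fun p : Fin q × Fin q => A p.1 * M * A p.2)ᴴ *
        stack (fun p : Fin q × Fin q => A p.1 * N * A p.2) = heisenberg A (Mᴴ * gram A * N) := by
  rw [conjTranspose_stack_mul_stack, sum_conjTranspose_twoSite_mul_twoSite]

/-- The bond image in stacked form: `Y_X(A) = [A p₁ A p₂]ᴴ (X ⊗ 1) [A p₁ A p₂]`. -/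
theorem bondImage_eq_stack (A : MPSTensor q D) (X : Matrix (Fin q × Fin q) (Fin q × Fin q) ℂ) :
    bondImage A X = (stack fun p : Fin q × Fin q => A p.1 * 1 * A p.2)ᴴ *
      (X ⊗ₖ (1 : Matrix (Fin D) (Fin D) ℂ)) * stack (fun p : Fin q × Fin q => A p.1 * 1 * A p.2) := by
  rw [conjTranspose_stack_mul_kronecker_mul_stack, bondImage]
  simp only [Matrix.mul_one]

/-- `Φ_Ã(B) = S Φ_A(B) S`, `S = G^{-1/2}`. -/
theorem heisenberg_polarTensor (A : MPSTensor q D) (B : Matrix (Fin D) (Fin D) ℂ) :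
    heisenberg (polarTensor A) B = invSqrt (gram A) * heisenberg A B * invSqrt (gram A) := by
  simp only [heisenberg, polarTensor, conjTranspose_mul, conjTranspose_invSqrt, Matrix.mul_assoc,
    Finset.mul_sum, Finset.sum_mul]

/-- `Y_X(Ã) = S · [A p₁ S A p₂]ᴴ (X ⊗ 1) [A p₁ S A p₂] · S`. -/
theorem bondImage_polarTensor (A : MPSTensor q D) (X : Matrix (Fin q × Fin q) (Fin q × Fin q) ℂ) :
    bondImage (polarTensor A) X = invSqrt (gram A) *
      ((stack fun p : Fin q × Fin q => A p.1 * invSqrt (gram A) * A p.2)ᴴ *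
        (X ⊗ₖ (1 : Matrix (Fin D) (Fin D) ℂ)) *
        stack (fun p : Fin q × Fin q => A p.1 * invSqrt (gram A) * A p.2)) * invSqrt (gram A) := by
  have h1 : bondImage (polarTensor A) X =
      (stack fun p : Fin q × Fin q => A p.1 * invSqrt (gram A) * A p.2 * invSqrt (gram A))ᴴ *
        (X ⊗ₖ (1 : Matrix (Fin D) (Fin D) ℂ)) *
        stack (fun p : Fin q × Fin q => A p.1 * invSqrt (gram A) * A p.2 * invSqrt (gram A)) := by
    rw [conjTranspose_stack_mul_kronecker_mul_stack, bondImage]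
    simp only [polarTensor, Matrix.mul_assoc]
  rw [h1, stack_mul, conjTranspose_mul, conjTranspose_invSqrt]
  simp only [Matrix.mul_assoc]

/-! ### The exact isometry and the perturbation bound -/

/-- **`Ã` is exactly left-isometric**: `Σ_s (Ã s)ᴴ (Ã s) = 1` whenever `‖G - 1‖_∞ ≤ ε < 1`
(row sums). -/
theorem sum_conjTranspose_polarTensor_mul_self {A : MPSTensor q D} {ε : ℝ} (hε1 : ε < 1)
    (hG : ∀ i, ∑ j, ‖(gram A - 1) i j‖ ≤ ε) :
    ∑ s, (polarTensor A s)ᴴ * polarTensor A s = 1 := by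
  have hlo := (near_one_of_rowSum_le (gram_isHermitian A) hG).1
  exact sum_conjTranspose_mul_orthonormalize_of_near_one A hε1 hlo

end Summit.Ventures.CertifiedManyBodySolver.Upper

end
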